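import Literature.AnabelianGeometry.SemiGraphs.ThetaRayEscapeLevelData
import HarnessLib

/-!
# The coincidence binder of the escape at `𝒢_θ` from the twists `θ_m : a ↦ a·b^{p^m}` ([SemiAnbd] Thm 3.7 (iii))

Mochizuki, *Semi-graphs of anabelioids*, Publ. RIMS **42** (2006) [MochizukiSemiAnbd2006], Theorem 3.7 (iii)
p. 41; desk countermodel `𝒢_θ` of abc-iut-L3-d1 (memo HOME/staging/L3/L3-d1/g3/COUNTERMODEL-Thm37iii-infinite.md,
(2a): "`[z_k]_j = [z_{k+1}]_j` for `k+1 ≥ k_j`" because `b^{p^{n_{k+1}}}` dies at level `j`).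
[cite: MochizukiSemiAnbd2006, Thm 3.7(iii) p.41]

PROOF-ONLY file (abc-iut cell, FRONTIER programme REFUTE-F1732, brick R6 «LEVEL DATA at `thetaRayOfTwists`»,
sequel of `ThetaRayEscapeLevelData.lean`; seat abc-iut-L3-t11 gen 3; no definitions, no named facts).  The
group-theoretic coincidence binder (hcoin) «`(low (k+1) e₀)⁻¹ · up e₀ ∈ charOpenCore G d` for `k ≫ 0`» of
`thetaRay_not_compactInVerticialAt_of_hcrit` is DISCHARGED for the twisted ray `thetaRayOfTwists G E α θ n`
(`low k = θ_{n k} ∘ α`, `up = α`) from the R1/R1b interface in BINDER form (abc-iut-w6-d019 / abc-iut-w5-d215):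
an element `a = α e₀`, an element `b`, twists with `θ_m a = a · b^{p^m}`, an exponent sequence with `k ≤ n k`,
and «every characteristic open core of `G` contains some `b^{p^e}`» (for the pro-`p` completion `F̂₂⁽ᵖ⁾`:
abc-iut-w5-d215's `IsProSigmaCompletion.exists_pow_prime_pow_mem` at the open normal subgroup
`charOpenCore G d`, open by `isOpen_charOpenCore_of_tfg`):

* `inv_mul_twist_eq` — `(a · b^{p^m})⁻¹ · a = (b^{p^m})⁻¹`;
* `thetaRayOfTwists_hcoin` — (hcoin) for `thetaRayOfTwists`;
* `thetaRayOfTwists_not_compactInVerticialAt_of_hcrit`, `thetaRayOfTwists_not_compactInVerticial_of_hcrit` —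
  `¬ CompactInVerticialAt (thetaRayOfTwists G E α θ n)` (resp. `¬ CompactInVerticial.{0}`) from
  `Thm37Hypotheses`, the R1/R1b binders above, and the ONE remaining binder (hcrit) of abc-iut-L3-d4's
  assembly for the explicit apartment generators `z k = ψ_{k+1}(α e₀)`.

Towards a kernel erratum for the ∀-countable reading of [SemiAnbd] Thm 3.7 (iii) ([IUTchI] Rmk 2.5.3); print
proves finite `𝔾` (kernel: `compactInVerticialAt_of_finiteGraph`); IUT uses finite dual semi-graphs only.
Nothing here bears on [IUTchIII] Cor. 3.12; typed ≠ proved; no refutation is claimed in this file (the binder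
(hcrit) remains).
-/

noncomputable section

namespace Literature.AnabelianGeometry.SemiGraphs

open CategoryTheory Topology
open ProfiniteSemiGraph ProfiniteSemiGraph.GaloisLevelData

/-! ### The group-theoretic coincidence -/

section Group

variable {G : Type*} [Group G]

/-- In any group `(a · c)⁻¹ · a = c⁻¹ · a⁻¹ · a = c⁻¹`. [cite: MochizukiSemiAnbd2006, Thm 3.7(iii) p.41] -/
theorem inv_mul_self_mul_eq_inv (a c : G) : (a * c)⁻¹ * a = c⁻¹ := by
  rw [mul_inv_rev, inv_mul_cancel_right]

/-- **`(θ_m a)⁻¹ · a = (b^{p^m})⁻¹` for a twist `θ_m a = a · b^{p^m}`.** [cite: MochizukiSemiAnbd2006, Thm 3.7(iii) p.41] -/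
theorem inv_mul_twist_eq {a b : G} {p m : ℕ} {θ : G → G} (hθa : θ a = a * b ^ (p ^ m)) :
    (θ a)⁻¹ * a = (b ^ (p ^ m))⁻¹ := by
  rw [hθa, inv_mul_self_mul_eq_inv]

/-- **(hcoin) from the twists**: if every subgroup `U d` of a prescribed family contains some `b^{p^e}` and
`θ_m a = a · b^{p^m}`, then for an exponent sequence with `k ≤ n k`, `(θ_{n (k+1)} a)⁻¹ · a ∈ U d` for all
`k ≥ e`. [cite: MochizukiSemiAnbd2006, Thm 3.7(iii) p.41] -/
theorem eventually_inv_mul_twist_mem {a b : G} {p : ℕ} (θ : ℕ → G → G)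
    (hθa : ∀ m, θ m a = a * b ^ (p ^ m)) (n : ℕ → ℕ) (hn : ∀ k, k ≤ n k) (U : ℕ → Subgroup G)
    (hU : ∀ d, ∃ e, b ^ (p ^ e) ∈ U d) (d : ℕ) :
    ∃ N : ℕ, ∀ k, N ≤ k → (θ (n (k + 1)) a)⁻¹ * a ∈ U d := by
  obtain ⟨e, he⟩ := hU d
  refine ⟨e, fun k hk => ?_⟩
  rw [inv_mul_twist_eq (hθa (n (k + 1)))]
  obtain ⟨r, hr⟩ := Nat.exists_eq_add_of_le ((hk.trans (Nat.le_succ k)).trans (hn (k + 1)))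
  refine (U d).inv_mem ?_
  rw [hr, pow_add, pow_mul]
  exact (U d).pow_mem he _

end Group

/-! ### (hcoin) and the escape modulo (hcrit) for `thetaRayOfTwists` -/

variable {G E : Type} [Group G] [TopologicalSpace G] [IsTopologicalGroup G] [CompactSpace G]
  [TotallyDisconnectedSpace G] [Group E] [TopologicalSpace E] [IsTopologicalGroup E] [CompactSpace E]
  [TotallyDisconnectedSpace E] {α : E →ₜ* G} {θ : ℕ → (G →ₜ* G)} {n : ℕ → ℕ}

omit [IsTopologicalGroup G] [CompactSpace G] [TotallyDisconnectedSpace G] [IsTopologicalGroup E] [CompactSpace E]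
  [TotallyDisconnectedSpace E] in
/-- **(hcoin) for `thetaRayOfTwists G E α θ n`**: with `a := α e₀`, twists `θ_m a = a · b^{p^m}`, `k ≤ n k`, and
every characteristic open core containing some `b^{p^e}`, the element `(θ_{n(k+1)}(α e₀))⁻¹ · α e₀` lies in
`charOpenCore G d` for `k ≫ 0`. [cite: MochizukiSemiAnbd2006, Thm 3.7(iii) p.41] -/
theorem thetaRayOfTwists_hcoin (e₀ : E) {b : G} {p : ℕ} (hθa : ∀ m, θ m (α e₀) = α e₀ * b ^ (p ^ m))
    (hn : ∀ k, k ≤ n k) (hcore : ∀ d, ∃ e, b ^ (p ^ e) ∈ charOpenCore G d) :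
    ∀ d : ℕ, ∃ N : ℕ, ∀ k, N ≤ k →
      ((fun k => (θ (n k)).comp α) (k + 1) e₀)⁻¹ * α e₀ ∈ charOpenCore G d :=
  fun d => eventually_inv_mul_twist_mem (fun m x => θ m x) hθa n hn (fun d => charOpenCore G d) hcore d

/-- **The escape at `𝒢_θ = thetaRayOfTwists G E α θ n` modulo (hcrit)**: from `Thm37Hypotheses`, a base point
sequence `P₀` over `v_0` of the canonical tower, `e₀ ∈ E` with twists `θ_m (α e₀) = α e₀ · b^{p^m}`, `k ≤ n k`,
«every characteristic open core of `G` contains some `b^{p^e}`» (R1b), and abc-iut-L3-d4's binder (hcrit) for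
the explicit apartment generators `z k = ψ_{k+1}(α e₀)`, the first clause of [SemiAnbd] Thm 3.7 (iii) FAILS at
`𝒢_θ`. [cite: MochizukiSemiAnbd2006, Thm 3.7(iii) p.41] -/
theorem thetaRayOfTwists_not_compactInVerticialAt_of_hcrit (h37 : (thetaRayOfTwists G E α θ n).Thm37Hypotheses)
    (P₀ : ((thetaRayOfTwists G E α θ n).galoisLevelData h37.toProp36Hypotheses).PointSeq h37.isCountable (0 : ℕ))
    (e₀ : E) {b : G} {p : ℕ} (hθa : ∀ m, θ m (α e₀) = α e₀ * b ^ (p ^ m)) (hn : ∀ k, k ≤ n k)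
    (hcore : ∀ d, ∃ e, b ^ (p ^ e) ∈ charOpenCore G d)
    (hcrit : let D := (thetaRayOfTwists G E α θ n).galoisLevelData h37.toProp36Hypotheses
      let z : ℕ → D.temperedPi h37.isCountable := fun k =>
        (rayPointSeq (D := D) thetaRay_ham thetaRay_hap thetaRay_hmp P₀ (k + 1)).decompHom
          ((thetaRayOfTwists G E α θ n).brHom (k, true) (k + 1) (thetaRay_hap k) e₀)
      ∀ m : ℕ, ∃ j₀ : ℕ, ∀ j, j₀ ≤ j → ∃ N : ℕ, ∀ k, N ≤ k →
        ∀ (y : (D.tree j).Vertex) (c c' : (D.tree j).Branch),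
          (D.tree j).abuts c = some y → (D.tree j).abuts c' = some y →
          (D.treeProj j).vertexMap y = m + 1 →
          (D.treeAct h37.isCountable j (z k)).hom.edgeMap ((D.tree j).edgeOf c) = (D.tree j).edgeOf c →
          (D.treeAct h37.isCountable j (z k)).hom.edgeMap ((D.tree j).edgeOf c') = (D.tree j).edgeOf c' →
          (∃ (c₂ : (D.tree j).Branch) (v₂ : (D.tree j).Vertex), c₂ ≠ c ∧
            (D.tree j).edgeOf c₂ = (D.tree j).edgeOf c ∧ (D.tree j).abuts c₂ = some v₂ ∧
            (D.treeProj j).vertexMap v₂ = m + 2) →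
          (∃ (c₂ : (D.tree j).Branch) (v₂ : (D.tree j).Vertex), c₂ ≠ c' ∧
            (D.tree j).edgeOf c₂ = (D.tree j).edgeOf c' ∧ (D.tree j).abuts c₂ = some v₂ ∧
            (D.treeProj j).vertexMap v₂ = m) →
          False) :
    ¬ CompactInVerticialAt (thetaRayOfTwists G E α θ n) :=
  thetaRay_not_compactInVerticialAt_of_hcrit h37 P₀ e₀ (thetaRayOfTwists_hcoin e₀ hθa hn hcore) hcrit

/-- … hence the ∀-countable named fact `CompactInVerticial.{0}` fails (modulo (hcrit) at `𝒢_θ`).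
[cite: MochizukiSemiAnbd2006, Thm 3.7(iii) p.41] -/
theorem thetaRayOfTwists_not_compactInVerticial_of_hcrit (h37 : (thetaRayOfTwists G E α θ n).Thm37Hypotheses)
    (P₀ : ((thetaRayOfTwists G E α θ n).galoisLevelData h37.toProp36Hypotheses).PointSeq h37.isCountable (0 : ℕ))
    (e₀ : E) {b : G} {p : ℕ} (hθa : ∀ m, θ m (α e₀) = α e₀ * b ^ (p ^ m)) (hn : ∀ k, k ≤ n k)
    (hcore : ∀ d, ∃ e, b ^ (p ^ e) ∈ charOpenCore G d)
    (hcrit : let D := (thetaRayOfTwists G E α θ n).galoisLevelData h37.toProp36Hypotheses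
      let z : ℕ → D.temperedPi h37.isCountable := fun k =>
        (rayPointSeq (D := D) thetaRay_ham thetaRay_hap thetaRay_hmp P₀ (k + 1)).decompHom
          ((thetaRayOfTwists G E α θ n).brHom (k, true) (k + 1) (thetaRay_hap k) e₀)
      ∀ m : ℕ, ∃ j₀ : ℕ, ∀ j, j₀ ≤ j → ∃ N : ℕ, ∀ k, N ≤ k →
        ∀ (y : (D.tree j).Vertex) (c c' : (D.tree j).Branch),
          (D.tree j).abuts c = some y → (D.tree j).abuts c' = some y →
          (D.treeProj j).vertexMap y = m + 1 →
          (D.treeAct h37.isCountable j (z k)).hom.edgeMap ((D.tree j).edgeOf c) = (D.tree j).edgeOf c →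
          (D.treeAct h37.isCountable j (z k)).hom.edgeMap ((D.tree j).edgeOf c') = (D.tree j).edgeOf c' →
          (∃ (c₂ : (D.tree j).Branch) (v₂ : (D.tree j).Vertex), c₂ ≠ c ∧
            (D.tree j).edgeOf c₂ = (D.tree j).edgeOf c ∧ (D.tree j).abuts c₂ = some v₂ ∧
            (D.treeProj j).vertexMap v₂ = m + 2) →
          (∃ (c₂ : (D.tree j).Branch) (v₂ : (D.tree j).Vertex), c₂ ≠ c' ∧
            (D.tree j).edgeOf c₂ = (D.tree j).edgeOf c' ∧ (D.tree j).abuts c₂ = some v₂ ∧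
            (D.treeProj j).vertexMap v₂ = m) →
          False) :
    ¬ CompactInVerticial.{0} := fun hCV =>
  thetaRayOfTwists_not_compactInVerticialAt_of_hcrit h37 P₀ e₀ hθa hn hcore hcrit
    (ProfiniteSemiGraph.compactInVerticial_iff_forall_at.mp hCV _)

end Literature.AnabelianGeometry.SemiGraphs

end
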